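import Summits.Ventures.Crystal3D.Bulk.SphPolygonCut
import Summits.Ventures.Crystal3D.Bulk.SphPolygonCap
import Summits.Ventures.Crystal3D.Bulk.SubtendedAngles
import HarnessLib

/-!
# Cutting a convex spherical polygon by a great circle does not increase the perimeter; one
# clipping step packaged — brick (S5) of (d3) «one rattler per p-hexagon»

HONEST FRAMING. Part of the venture `Summits/Ventures/Crystal3D` (cell `pub-crystal3d`, phase 2;
seat typer-bulk-2), generic and configuration-free; nothing here mentions GAP(1.26). Setting of
`Bulk/SphPolygonCut.lean`: the clipped polygon `cutPoly w ν n k = (w 0, …, w (k−1), B, A)` of a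
periodic window-convex polygon `w` along the great circle `ν⊥`. Here:

* `polyPerim v m = Σ_{j<m} ∠(v j, v (j+1))` (defined in `Bulk/HexPerimeterDefs.lean`) — the
  perimeter of a polygon given as a periodic sequence of vectors;
* **`polyPerim_cutPoly_le`** — `polyPerim (cutPoly w ν n k) (k+2) ≤ polyPerim w n`: the two
  old edges through the crossing points split additively
  (`angle_eq_angle_add_add_angle_add_of_mem_span`) and the cut-off boundary arc
  `B, w k, …, w (n−1), A` is at least the new chord `BA` (chain inequality `angle_le_sum_angle`
  of `Bulk/SubtendedAngles.lean`);
* `periodic_edges`, `periodic_vertices` — bookkeeping; **`cut_step`** — ONE CLIPPING STEP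
  PACKAGED: given a periodic window-convex polygon, a cutting normal `ν` and a point `y₀` of the
  closed cone with `⟪ν, y₀⟫ > 0`, either no vertex is strictly negative (nothing to cut) or, after
  a rotation (`Bulk/SphPolygonFan.lean`, `exists_sign_block`), the clipped polygon: again
  periodic and window convex, perimeter not larger, all vertices on the closed positive side of
  `ν`, inherited closed half-spaces, closed cone ⊇ old cone ∩ `{⟪·,ν⟫ ≥ 0}`, caps kept.
-/

noncomputable section

namespace Summit.Ventures.Crystal3D

open Literature.Geometry.DiscreteGeometry Real InnerProductGeometry Finset
open scoped InnerProductSpace RealInnerProductSpace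

section Cut

variable {n k : ℕ} {w : ℕ → EuclideanSpace ℝ (Fin 3)} {ν : EuclideanSpace ℝ (Fin 3)} (hn : 3 ≤ n) (hper : ∀ i, w (i + n) = w i)
  (hcx : ∀ i j k, i < j → j < k → k < i + n → 0 < orient3 (w i) (w j) (w k))
  (hk1 : 1 ≤ k) (hkn : k < n) (hpos : ∀ i, i < k → 0 < ⟪w i, ν⟫)
  (hnp : ∀ i, k ≤ i → i < n → ⟪w i, ν⟫ ≤ 0) (hneg : ∃ i, k ≤ i ∧ i < n ∧ ⟪w i, ν⟫ < 0)

/-! ### The perimeter does not increase -/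

include hn hper hcx hk1 hkn hpos hnp in
/-- **Cutting does not increase the perimeter** (the chain inequality for the cut-off arc). -/
theorem polyPerim_cutPoly_le : polyPerim (cutPoly w ν n k) (k + 2) ≤ polyPerim w n := by
  -- nonzero-ness of the crossing points and their position on the old edges
  have hb1 := hpos (k - 1) (by omega)
  have hb2 : 0 ≤ -⟪w k, ν⟫ := neg_nonneg.2 (hnp k le_rfl hkn)
  have ha1 := hpos 0 (by omega)
  have ha2 : 0 ≤ -⟪w (n - 1), ν⟫ := neg_nonneg.2 (hnp (n - 1) (by omega) (by omega))
  have hBne : cutB w ν k ≠ 0 := by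
    intro h0
    have h := hcx (k - 1) k (k + 1) (by omega) (by omega) (by omega)
    have : orient3 (w (k - 1)) (cutB w ν k) (w (k + 1)) = 0 := by rw [h0]; simp [orient3]
    unfold cutB at this
    rw [orient3_add_mid, orient3_smul_mid, orient3_smul_mid, orient3_self_left, mul_zero, add_zero]
      at this
    rcases mul_eq_zero.1 this with h1 | h1
    · linarith
    · linarith
  have hAne : cutA w ν n ≠ 0 := by
    intro h0
    have h := hcx (n - 1) n (n + 1) (by omega) (by omega) (by omega)
    rw [show w n = w 0 by rw [← hper 0, zero_add],
      show w (n + 1) = w 1 by rw [show n + 1 = 1 + n by ring, hper 1]] at h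
    have : orient3 (cutA w ν n) (w 0) (w 1) = 0 := by rw [h0]; simp [orient3]
    unfold cutA at this
    rw [orient3_add_left, orient3_smul_left, orient3_smul_left, orient3_self_left, mul_zero,
      add_zero] at this
    rcases mul_eq_zero.1 this with h1 | h1
    · linarith
    · linarith
  -- splitting the two old edges at the crossing points
  have hsplitB : angle (w (k - 1)) (w k) =
      angle (w (k - 1)) (cutB w ν k) + angle (cutB w ν k) (w k) := by
    apply angle_eq_angle_add_add_angle_add_of_mem_span hBne
    have : cutB w ν k = (-⟪w k, ν⟫) • w (k - 1) + ⟪w (k - 1), ν⟫ • w k := by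
      unfold cutB; rw [add_comm]
    rw [this]
    exact mem_span_pair_of_nonneg hb2 hb1.le
  have hsplitA : angle (w (n - 1)) (w 0) =
      angle (w (n - 1)) (cutA w ν n) + angle (cutA w ν n) (w 0) := by
    apply angle_eq_angle_add_add_angle_add_of_mem_span hAne
    unfold cutA
    exact mem_span_pair_of_nonneg ha1.le ha2
  -- the chain from `B` through `w k, …, w (n−1)` to `A`
  obtain ⟨f, hf⟩ : ∃ f : ℕ → EuclideanSpace ℝ (Fin 3), f = fun t => if t = 0 then cutB w ν k else
      if t ≤ n - k then w (k - 1 + t) else cutA w ν n := ⟨_, rfl⟩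
  have hf0 : f 0 = cutB w ν k := by rw [hf]; simp
  have hfmid : ∀ t, 1 ≤ t → t ≤ n - k → f t = w (k - 1 + t) := by
    intro t h1 h2; rw [hf]; simp only; rw [if_neg (by omega), if_pos h2]
  have hflast : f (n - k + 1) = cutA w ν n := by
    rw [hf]; simp only; rw [if_neg (by omega), if_neg (by omega)]
  have hchain := angle_le_sum_angle f (show 0 < n - k + 1 by omega)
  rw [hf0, hflast] at hchain
  -- evaluate the chain sum: first term, middle terms, last term
  have hsum : ∑ t ∈ Ico 0 (n - k + 1), angle (f t) (f (t + 1)) =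
      angle (cutB w ν k) (w k) + ∑ t ∈ Ico 1 (n - k), angle (w (k - 1 + t)) (w (k + t)) +
        angle (w (n - 1)) (cutA w ν n) := by
    rw [show Ico 0 (n - k + 1) = range (n - k + 1) from Nat.Ico_zero_eq_range _,
      Finset.sum_range_succ, ← Finset.sum_range_add_sum_Ico _ (show 1 ≤ n - k by omega),
      Finset.sum_range_one, hf0, hfmid 1 le_rfl (by omega), show k - 1 + 1 = k by omega]
    congr 1
    · congr 1
      apply Finset.sum_congr rfl
      intro t ht
      rw [mem_Ico] at ht
      rw [hfmid t ht.1 ht.2.le, hfmid (t + 1) (by omega) (by omega), show k - 1 + (t + 1) = k + t by omega]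
    · rw [hfmid (n - k) (by omega) le_rfl, hflast, show k - 1 + (n - k) = n - 1 by omega]
  rw [hsum] at hchain
  -- the middle sum is the old edges `k, …, n−2`
  have hmid : ∑ t ∈ Ico 1 (n - k), angle (w (k - 1 + t)) (w (k + t)) =
      ∑ j ∈ Ico k (n - 1), angle (w j) (w (j + 1)) := by
    have h := Finset.sum_Ico_add' (fun j => angle (w j) (w (j + 1))) 1 (n - k) (k - 1)
    rw [show 1 + (k - 1) = k by omega, show n - k + (k - 1) = n - 1 by omega] at h
    rw [← h]
    apply Finset.sum_congr rfl
    intro t _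
    rw [show k - 1 + t = t + (k - 1) by omega, show k + t = t + (k - 1) + 1 by omega]
  -- assemble both perimeters
  unfold polyPerim
  obtain ⟨k', rfl⟩ : ∃ k', k = k' + 1 := ⟨k - 1, by omega⟩
  simp only [Nat.add_sub_cancel] at *
  rw [show k' + 1 + 2 = k' + 3 by ring, Finset.sum_range_succ, Finset.sum_range_succ,
    Finset.sum_range_succ]
  rw [show k' + 2 + 1 = k' + 1 + 2 by ring, cutPoly_k2 hk1, show k' + 1 + 1 = k' + 1 + 1 from rfl,
    cutPoly_k1, show k' + 1 = k' + 1 from rfl, cutPoly_k, cutPoly_of_lt (by omega : k' < k' + 1)]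
  have hfirst : ∑ x ∈ range k', angle (cutPoly w ν n (k' + 1) x) (cutPoly w ν n (k' + 1) (x + 1)) =
      ∑ x ∈ range k', angle (w x) (w (x + 1)) := by
    apply Finset.sum_congr rfl
    intro x hx; rw [mem_range] at hx
    rw [cutPoly_of_lt (by omega), cutPoly_of_lt (by omega)]
  rw [hfirst]
  -- the old perimeter: `range n = range k' ∪ {k'} ∪ Ico (k'+1) (n−1) ∪ {n−1}`
  have hold : ∑ j ∈ range n, angle (w j) (w (j + 1)) =
      ∑ j ∈ range k', angle (w j) (w (j + 1)) + angle (w k') (w (k' + 1)) +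
        ∑ j ∈ Ico (k' + 1) (n - 1), angle (w j) (w (j + 1)) + angle (w (n - 1)) (w 0) := by
    rw [← Finset.sum_range_add_sum_Ico _ (show n - 1 ≤ n by omega),
      show Ico (n - 1) n = {n - 1} by rw [← Nat.Ico_succ_singleton]; congr 1; omega,
      Finset.sum_singleton, show n - 1 + 1 = n by omega, show w n = w 0 by rw [← hper 0, zero_add],
      ← Finset.sum_range_add_sum_Ico _ (show k' + 1 ≤ n - 1 by omega), Finset.sum_range_succ]
  rw [hold]
  rw [hmid] at hchain
  linarith [hsplitB, hsplitA, hchain]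

end Cut

/-! ### Periodic extension of edge conditions -/

/-- Edge conditions over one period hold for every index of a periodic polygon. -/
theorem periodic_edges {m : ℕ} {v : ℕ → EuclideanSpace ℝ (Fin 3)} (hm : 1 ≤ m)
    (hper : ∀ i, v (i + m) = v i) {Q : EuclideanSpace ℝ (Fin 3) → EuclideanSpace ℝ (Fin 3) → Prop}
    (h : ∀ i, i < m → Q (v i) (v (i + 1))) : ∀ i, Q (v i) (v (i + 1)) := by
  intro i
  have := shift_edges 0 hper hm h
  have hperk : ∀ i q, v (i + q * m) = v i := by
    intro i q
    induction q with
    | zero => simp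
    | succ q ih => rw [Nat.succ_mul, ← add_assoc, hper, ih]
  have e1 : v i = v (i % m) := by
    conv_lhs => rw [← Nat.mod_add_div' i m, hperk]
  have e2 : v (i + 1) = v (i % m + 1) := by
    conv_lhs => rw [show i + 1 = (i % m + 1) + i / m * m by
      have := Nat.mod_add_div' i m; omega, hperk]
  rw [e1, e2]
  exact h _ (Nat.mod_lt _ (by omega))

/-- Vertex conditions over one period hold for every index of a periodic polygon. -/
theorem periodic_vertices {m : ℕ} {v : ℕ → EuclideanSpace ℝ (Fin 3)} (hm : 1 ≤ m)
    (hper : ∀ i, v (i + m) = v i) {Q : EuclideanSpace ℝ (Fin 3) → Prop}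
    (h : ∀ i, i < m → Q (v i)) : ∀ i, Q (v i) :=
  periodic_edges hm hper (Q := fun a _ => Q a) h

/-! ### One clipping step, packaged -/

/-- **One clipping step.** See the module docstring. -/
theorem cut_step {n : ℕ} {w : ℕ → EuclideanSpace ℝ (Fin 3)} (hn : 3 ≤ n)
    (hper : ∀ i, w (i + n) = w i)
    (hcx : ∀ i j k, i < j → j < k → k < i + n → 0 < orient3 (w i) (w j) (w k))
    (ν : EuclideanSpace ℝ (Fin 3)) {y₀ : EuclideanSpace ℝ (Fin 3)}
    (hy₀K : ∀ i, 0 ≤ orient3 (w i) (w (i + 1)) y₀) (hy₀ : 0 < ⟪y₀, ν⟫) :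
    ∃ (m : ℕ) (v : ℕ → EuclideanSpace ℝ (Fin 3)), 3 ≤ m ∧ (∀ i, v (i + m) = v i) ∧
      (∀ i j k, i < j → j < k → k < i + m → 0 < orient3 (v i) (v j) (v k)) ∧
      polyPerim v m ≤ polyPerim w n ∧
      (∀ j, 0 ≤ ⟪v j, ν⟫) ∧
      (∀ μ : EuclideanSpace ℝ (Fin 3), (∀ i, 0 ≤ ⟪w i, μ⟫) → ∀ j, 0 ≤ ⟪v j, μ⟫) ∧
      (∀ y : EuclideanSpace ℝ (Fin 3), (∀ i, 0 ≤ orient3 (w i) (w (i + 1)) y) → 0 ≤ ⟪y, ν⟫ →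
        ∀ j, 0 ≤ orient3 (v j) (v (j + 1)) y) ∧
      (∀ (z : EuclideanSpace ℝ (Fin 3)) (s : ℝ),
        (∀ i, s * ‖cross3 (w i) (w (i + 1))‖ ≤ orient3 (w i) (w (i + 1)) z) →
        s * ‖ν‖ ≤ ⟪ν, z⟫ → ∀ j, s * ‖cross3 (v j) (v (j + 1))‖ ≤ orient3 (v j) (v (j + 1)) z) := by
  classical
  by_cases hneg : ∃ i, i < n ∧ ⟪w i, ν⟫ < 0
  · -- a strictly negative vertex: rotate to the sign block and clip
    have hw0 : w n = w 0 := by rw [← hper 0, zero_add]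
    obtain ⟨p, hpn, hp⟩ := exists_inner_pos_vertex hn hcx hw0 ν (fun i _ => hy₀K i) hy₀
    obtain ⟨r, k, hk1, hkn, hpos, hnp, hneg'⟩ := exists_sign_block hn hper hcx ν hneg ⟨p, hpn, hp⟩
    -- the rotated polygon
    obtain ⟨u, hu⟩ : ∃ u : ℕ → EuclideanSpace ℝ (Fin 3), ∀ i, u i = w (i + r) := ⟨_, fun _ => rfl⟩
    have huper : ∀ i, u (i + n) = u i := fun i => by rw [hu, hu]; exact shift_periodic r hper i
    have hucx : ∀ i j k, i < j → j < k → k < i + n → 0 < orient3 (u i) (u j) (u k) :=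
      fun i j k h1 h2 h3 => by rw [hu, hu, hu]; exact shift_convex r hcx i j k h1 h2 h3
    have hupos : ∀ i, i < k → 0 < ⟪u i, ν⟫ := fun i hi => by
      rw [hu, add_comm]; exact hpos i hi
    have hunp : ∀ i, k ≤ i → i < n → ⟪u i, ν⟫ ≤ 0 := fun i h1 h2 => by
      rw [hu, add_comm]; exact hnp i h1 h2
    have huneg : ∃ i, k ≤ i ∧ i < n ∧ ⟪u i, ν⟫ < 0 := by
      obtain ⟨i, h1, h2, h3⟩ := hneg'; exact ⟨i, h1, h2, by rw [hu, add_comm]; exact h3⟩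
    have huedge : ∀ i, u (i + 1) = w (i + r + 1) := fun i => by rw [hu, show i + 1 + r = i + r + 1 by ring]
    refine ⟨k + 2, cutPoly u ν n k, by omega, cutPoly_periodic,
      convexPos_window (by omega) cutPoly_periodic (cutPoly_convex_std hn hucx hk1 hkn hupos hunp huneg),
      ?_, ?_, ?_, ?_, ?_⟩
    · -- perimeter
      have hpu : polyPerim u n = polyPerim w n := by
        unfold polyPerim
        have : ∀ i, angle (u i) (u (i + 1)) = angle (w (i + r)) (w (i + r + 1)) := fun i => by
          rw [huedge, hu]
        simp only [this]
        exact sum_period_shift r hper (fun a b => angle a b)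
      calc polyPerim (cutPoly u ν n k) (k + 2) ≤ polyPerim u n :=
            polyPerim_cutPoly_le hn huper hucx hk1 hkn hupos hunp
        _ = polyPerim w n := hpu
    · exact cutPoly_inner_nonneg hupos
    · intro μ hμ j
      exact cutPoly_inherit hn hk1 hkn hupos hunp (fun i _ => by rw [hu]; exact hμ _) j
    · intro y hy hyν
      have h := cutPoly_cone hn huper hucx hk1 hkn hupos hunp huneg
        (fun i _ => by rw [huedge, hu]; exact hy _) hyν
      exact periodic_edges (by omega) cutPoly_periodic (Q := fun a b => 0 ≤ orient3 a b y) h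
    · intro z s hz hνz
      have h := cutPoly_caps hn huper hucx hk1 hkn hupos hunp huneg
        (fun i _ => by rw [huedge, hu]; exact hz _) hνz
      exact periodic_edges (by omega) cutPoly_periodic
        (Q := fun a b => s * ‖cross3 a b‖ ≤ orient3 a b z) h
  · -- no strictly negative vertex: keep the polygon
    have hall : ∀ i, 0 ≤ ⟪w i, ν⟫ := by
      apply periodic_vertices (by omega) hper (Q := fun a => 0 ≤ ⟪a, ν⟫)
      intro i hi
      by_contra h
      exact hneg ⟨i, hi, lt_of_not_ge h⟩
    exact ⟨n, w, hn, hper, hcx, le_rfl, hall, fun μ hμ => hμ, fun y hy _ => hy, fun z s hz _ => hz⟩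

end Summit.Ventures.Crystal3D

end
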